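import Summits.Ventures.PercRepro.C041BlockMapReductions

/-!
# ROW C-041 — THE PATH HOST: an edge replaced by a path with `n` internal vertices, and the reach of an old
vertex through it (p6, gen 35; the host of THEOREM (PATH), `C041BlockMapPath`)

Setting of `C041BlockMapReductions`.  For an unmarked host `Z₁` and an edge `e₀` with ends `x = fst e₀`,
`y = snd e₀`, the PATH host `pathHost Z₁ e₀ n` has the `n` new internal vertices `inr i` (`i : Fin n`) and the
`n + 1` SEGMENTS `inl e₀` (from `inl x` to the node `0`) and `inr i` (from `inr i` to the node `i + 1`), where
the node `j` is `inr j` for `j < n` and `inl y` for `j = n` (`pathNode`); every other edge `inl e` keeps its ends.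
A colouring `ω'` of the path host AGREES (`pathAgree`) when its `n` new segments all carry the colour of
`inl e₀`: then the path acts, for both colours, exactly as the edge `e₀` (`reflTransGen_path_iff` with `H = Z₁`,
through the chain `path_chain`); otherwise no monochromatic path crosses it and the statuses are those of the
loopified host (`H = loopify Z₁ e₀`).  The invariant of the reach lemma reads the position of a path vertex:
`inr i` is reached from an old vertex `v` iff the segments from `x` to the node `i` are all of colour `c` and `v`
reaches `x`, or the segments from the node `i` to `y` are all of colour `c` and `v` reaches `y`.  Hence every
status of an old vertex (merged / reached) is read off `Z₁` or `loopify Z₁ e₀` under the restricted colouring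
`ω' ∘ inl` (`Mg_path_agree`, `Rd_path_agree`, `Mg_path_disagree`, `Rd_path_disagree`); the block map of the path
host is computed in `C041BlockMapPath` (THEOREM (PATH)).
-/

namespace PercRepro

namespace ZoneZ

namespace MultiExit

open ZoneData Pendant Finset TwoExit TreeClosure

variable {V₁ E₁ U₁ U₂ : Type} (Z₁ : ZoneData V₁ E₁ U₁ U₂) (e₀ : E₁) (n : ℕ)

/-! ## Agreeing colourings and the nodes of the path -/

/-- A colouring of the path host AGREES when the `n` new segments all carry the colour of the segment `inl e₀`. -/
def pathAgree (ω' : E₁ ⊕ Fin n → Bool) : Prop := ∀ i : Fin n, ω' (Sum.inr i) = ω' (Sum.inl e₀)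

/-- A glued colouring agrees iff the colouring of the new segments is constant at the colour of `e₀`. -/
theorem pathAgree_elim_iff (ω : E₁ → Bool) (τ : Fin n → Bool) :
    pathAgree e₀ n (Sum.elim ω τ) ↔ τ = fun _ => ω e₀ := by
  unfold pathAgree
  simp only [Sum.elim_inl, Sum.elim_inr]
  exact ⟨fun h => funext h, fun h i => congrFun h i⟩

/-- The node `j` of the path, `0 ≤ j ≤ n`: the internal vertex `inr j` for `j < n`, the end `inl (snd e₀)` for
`j = n` (and beyond). -/
def pathNode (j : ℕ) : V₁ ⊕ Fin n := if h : j < n then Sum.inr ⟨j, h⟩ else Sum.inl (Z₁.snd e₀)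

/-- The node `j < n` is the internal vertex `inr j`. -/
theorem pathNode_of_lt {j : ℕ} (h : j < n) : pathNode Z₁ e₀ n j = Sum.inr ⟨j, h⟩ := dif_pos h

/-- The node `j ≥ n` is the end `inl (snd e₀)`. -/
theorem pathNode_of_not_lt {j : ℕ} (h : ¬ j < n) : pathNode Z₁ e₀ n j = Sum.inl (Z₁.snd e₀) := dif_neg h

variable [DecidableEq E₁]

/-! ## The path host -/

/-- The host with the edge `e₀` replaced by a PATH with the `n` internal vertices `inr i`: the segment `inl e₀`
joins `inl (fst e₀)` to the node `0`, the segment `inr i` joins `inr i` to the node `i + 1`, every other edge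
`inl e` keeps its ends. -/
def pathHost : ZoneData (V₁ ⊕ Fin n) (E₁ ⊕ Fin n) U₁ U₂ where
  fst := fun e => match e with
    | Sum.inl e => Sum.inl (Z₁.fst e)
    | Sum.inr i => Sum.inr i
  snd := fun e => match e with
    | Sum.inl e => if e = e₀ then pathNode Z₁ e₀ n 0 else Sum.inl (Z₁.snd e)
    | Sum.inr i => pathNode Z₁ e₀ n (i.1 + 1)
  at₁ := fun t => Sum.inl (Z₁.at₁ t)
  at₂ := fun t => Sum.inl (Z₁.at₂ t)

/-- The first end of an old edge. -/
theorem path_fst_inl (e : E₁) : (pathHost Z₁ e₀ n).fst (Sum.inl e) = Sum.inl (Z₁.fst e) := rfl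
/-- The second end of an old edge other than `e₀`. -/
theorem path_snd_inl_of_ne {e : E₁} (h : e ≠ e₀) :
    (pathHost Z₁ e₀ n).snd (Sum.inl e) = Sum.inl (Z₁.snd e) := by
  show (if e = e₀ then pathNode Z₁ e₀ n 0 else Sum.inl (Z₁.snd e)) = _
  rw [if_neg h]
/-- The second end of the segment `inl e₀`: the node `0`. -/
theorem path_snd_inl_self : (pathHost Z₁ e₀ n).snd (Sum.inl e₀) = pathNode Z₁ e₀ n 0 := by
  show (if e₀ = e₀ then pathNode Z₁ e₀ n 0 else Sum.inl (Z₁.snd e₀)) = _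
  rw [if_pos rfl]
/-- The first end of the segment `inr i`: the internal vertex `inr i`. -/
theorem path_fst_inr (i : Fin n) : (pathHost Z₁ e₀ n).fst (Sum.inr i) = Sum.inr i := rfl
/-- The second end of the segment `inr i`: the node `i + 1`. -/
theorem path_snd_inr (i : Fin n) : (pathHost Z₁ e₀ n).snd (Sum.inr i) = pathNode Z₁ e₀ n (i.1 + 1) := rfl

/-- `Joins` of an old edge other than `e₀`. -/
theorem path_joins_inl_of_ne {e : E₁} (h : e ≠ e₀) (z z' : V₁ ⊕ Fin n) :
    (pathHost Z₁ e₀ n).Joins (Sum.inl e) z z' ↔ ∃ x y, z = Sum.inl x ∧ z' = Sum.inl y ∧ Z₁.Joins e x y := by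
  unfold Joins
  rw [path_fst_inl, path_snd_inl_of_ne Z₁ e₀ n h]
  constructor
  · rintro (⟨h1, h2⟩ | ⟨h1, h2⟩)
    · exact ⟨_, _, h1.symm, h2.symm, Or.inl ⟨rfl, rfl⟩⟩
    · exact ⟨_, _, h2.symm, h1.symm, Or.inr ⟨rfl, rfl⟩⟩
  · rintro ⟨x, y, rfl, rfl, (⟨rfl, rfl⟩ | ⟨rfl, rfl⟩)⟩
    · exact Or.inl ⟨rfl, rfl⟩
    · exact Or.inr ⟨rfl, rfl⟩

/-- `Joins` of the segment `inl e₀`. -/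
theorem path_joins_inl_self (z z' : V₁ ⊕ Fin n) :
    (pathHost Z₁ e₀ n).Joins (Sum.inl e₀) z z' ↔
      (z = Sum.inl (Z₁.fst e₀) ∧ z' = pathNode Z₁ e₀ n 0) ∨
        (z = pathNode Z₁ e₀ n 0 ∧ z' = Sum.inl (Z₁.fst e₀)) := by
  unfold Joins
  rw [path_fst_inl, path_snd_inl_self]
  constructor
  · rintro (⟨h1, h2⟩ | ⟨h1, h2⟩)
    · exact Or.inl ⟨h1.symm, h2.symm⟩
    · exact Or.inr ⟨h2.symm, h1.symm⟩
  · rintro (⟨rfl, rfl⟩ | ⟨rfl, rfl⟩)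
    · exact Or.inl ⟨rfl, rfl⟩
    · exact Or.inr ⟨rfl, rfl⟩

/-- `Joins` of the segment `inr i`. -/
theorem path_joins_inr (i : Fin n) (z z' : V₁ ⊕ Fin n) :
    (pathHost Z₁ e₀ n).Joins (Sum.inr i) z z' ↔
      (z = Sum.inr i ∧ z' = pathNode Z₁ e₀ n (i.1 + 1)) ∨
        (z = pathNode Z₁ e₀ n (i.1 + 1) ∧ z' = Sum.inr i) := by
  unfold Joins
  rw [path_fst_inr, path_snd_inr]
  constructor
  · rintro (⟨h1, h2⟩ | ⟨h1, h2⟩)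
    · exact Or.inl ⟨h1.symm, h2.symm⟩
    · exact Or.inr ⟨h2.symm, h1.symm⟩
  · rintro (⟨rfl, rfl⟩ | ⟨rfl, rfl⟩)
    · exact Or.inl ⟨rfl, rfl⟩
    · exact Or.inr ⟨rfl, rfl⟩

/-! ## The chain: an agreeing colouring carries the path -/

section Chain

variable (c : Bool) (ω' : E₁ ⊕ Fin n → Bool)

/-- Under a colouring with every segment of colour `c`, `inl (fst e₀)` reaches every node of the path. -/
theorem path_chain_node (hc : ω' (Sum.inl e₀) = c) (hall : ∀ j : Fin n, ω' (Sum.inr j) = c) :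
    ∀ j, j ≤ n → Relation.ReflTransGen (cAdj (pathHost Z₁ e₀ n) c ω') (Sum.inl (Z₁.fst e₀))
      (pathNode Z₁ e₀ n j) := by
  intro j
  induction j with
  | zero =>
    intro _
    exact Relation.ReflTransGen.single
      ⟨Sum.inl e₀, (path_joins_inl_self Z₁ e₀ n _ _).2 (Or.inl ⟨rfl, rfl⟩), hc⟩
  | succ j ih =>
    intro hj
    have hjn : j < n := hj
    refine (ih (Nat.le_of_lt hjn)).tail ⟨Sum.inr ⟨j, hjn⟩, ?_, hall _⟩
    rw [pathNode_of_lt Z₁ e₀ n hjn]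
    exact (path_joins_inr Z₁ e₀ n ⟨j, hjn⟩ _ _).2 (Or.inl ⟨rfl, rfl⟩)

/-- Under a colouring with every segment of colour `c`, the path is a monochromatic path from `inl (fst e₀)` to
`inl (snd e₀)`. -/
theorem path_chain (hc : ω' (Sum.inl e₀) = c) (hall : ∀ j : Fin n, ω' (Sum.inr j) = c) :
    Relation.ReflTransGen (cAdj (pathHost Z₁ e₀ n) c ω') (Sum.inl (Z₁.fst e₀)) (Sum.inl (Z₁.snd e₀)) := by
  have h := path_chain_node Z₁ e₀ n c ω' hc hall n (le_refl n)
  rwa [pathNode_of_not_lt Z₁ e₀ n (lt_irrefl n)] at h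

end Chain

/-! ## The reach of an old vertex in the path host -/

section Reach

variable (c : Bool) (ω' : E₁ ⊕ Fin n → Bool) (H : ZoneData V₁ E₁ U₁ U₂)

/-- **The reach of an old vertex in the path host**, read off a host `H` on the old vertices that agrees with
`Z₁` off `e₀` (`hH1`), whose `e₀`-steps are trivial or, when the colouring agrees, steps of `Z₁` along `e₀`
(`hH2`), and which carries the edge `e₀` when the colouring agrees (`hH3`): a monochromatic path of the path host
between old vertices is a monochromatic path of `H` under the restricted colouring.  The invariant: a path vertex
`inr i` is reached iff the segments from `fst e₀` to the node `i` are all of colour `c` and `fst e₀` is reached,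
or the segments from the node `i` to `snd e₀` are all of colour `c` and `snd e₀` is reached. -/
theorem reflTransGen_path_iff
    (hH1 : ∀ e, e ≠ e₀ → ∀ x y, H.Joins e x y ↔ Z₁.Joins e x y)
    (hH2 : ∀ x y, H.Joins e₀ x y → x = y ∨ (pathAgree e₀ n ω' ∧ Z₁.Joins e₀ x y))
    (hH3 : pathAgree e₀ n ω' → H.Joins e₀ (Z₁.fst e₀) (Z₁.snd e₀)) (v v' : V₁) :
    Relation.ReflTransGen (cAdj (pathHost Z₁ e₀ n) c ω') (Sum.inl v) (Sum.inl v') ↔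
      Relation.ReflTransGen (cAdj H c fun e => ω' (Sum.inl e)) v v' := by
  constructor
  · intro h
    -- the invariant along the path
    have key : ∀ z, Relation.ReflTransGen (cAdj (pathHost Z₁ e₀ n) c ω') (Sum.inl v) z →
        (∀ x, z = Sum.inl x → Relation.ReflTransGen (cAdj H c fun e => ω' (Sum.inl e)) v x) ∧
        (∀ i : Fin n, z = Sum.inr i →
          ((ω' (Sum.inl e₀) = c ∧ ∀ j : Fin n, j.1 < i.1 → ω' (Sum.inr j) = c) ∧
              Relation.ReflTransGen (cAdj H c fun e => ω' (Sum.inl e)) v (Z₁.fst e₀)) ∨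
            ((∀ j : Fin n, i.1 ≤ j.1 → ω' (Sum.inr j) = c) ∧
              Relation.ReflTransGen (cAdj H c fun e => ω' (Sum.inl e)) v (Z₁.snd e₀))) := by
      intro z hz
      induction hz with
      | refl =>
        refine ⟨fun x hx => ?_, fun i hi => nomatch hi⟩
        cases hx
        exact Relation.ReflTransGen.refl
      | tail hpath hstep ih =>
        rename_i z z'
        obtain ⟨e, hj, hc⟩ := hstep
        rcases e with e | i
        · by_cases he : e = e₀
          · subst he
            rw [path_joins_inl_self] at hj
            by_cases hn : 0 < n
            · rw [pathNode_of_lt Z₁ e n hn] at hj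
              rcases hj with ⟨rfl, rfl⟩ | ⟨rfl, rfl⟩
              · -- from `inl (fst e₀)` to the node `0`
                refine ⟨fun x hx => (nomatch hx), fun i hi => ?_⟩
                cases Sum.inr.inj hi
                exact Or.inl ⟨⟨hc, fun j hj => absurd hj (Nat.not_lt_zero _)⟩, ih.1 _ rfl⟩
              · -- from the node `0` to `inl (fst e₀)`
                refine ⟨fun x hx => ?_, fun i hi => nomatch hi⟩
                cases hx
                rcases ih.2 ⟨0, hn⟩ rfl with ⟨-, hp⟩ | ⟨hhi, hp⟩
                · exact hp
                · -- every segment has colour `c`: the colouring agrees and `H` carries `e₀`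
                  have hag : pathAgree e n ω' := fun j => (hhi j (Nat.zero_le _)).trans hc.symm
                  exact hp.tail ⟨e, (hH3 hag).symm, hc⟩
            · -- `n = 0`: the segment `inl e₀` joins the two old ends, and the colouring agrees
              rw [pathNode_of_not_lt Z₁ e n hn] at hj
              have hag : pathAgree e n ω' := fun j => (hn (lt_of_le_of_lt (Nat.zero_le _) j.2)).elim
              rcases hj with ⟨rfl, rfl⟩ | ⟨rfl, rfl⟩
              · refine ⟨fun x hx => ?_, fun i hi => nomatch hi⟩
                cases hx
                exact (ih.1 _ rfl).tail ⟨e, hH3 hag, hc⟩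
              · refine ⟨fun x hx => ?_, fun i hi => nomatch hi⟩
                cases hx
                exact (ih.1 _ rfl).tail ⟨e, (hH3 hag).symm, hc⟩
          · rw [path_joins_inl_of_ne Z₁ e₀ n he] at hj
            obtain ⟨x, y, rfl, rfl, hxy⟩ := hj
            refine ⟨fun x' hx' => ?_, fun i hi => nomatch hi⟩
            cases hx'
            exact (ih.1 x rfl).tail ⟨e, (hH1 e he x y).2 hxy, hc⟩
        · rw [path_joins_inr] at hj
          by_cases hlt : i.1 + 1 < n
          · rw [pathNode_of_lt Z₁ e₀ n hlt] at hj
            rcases hj with ⟨rfl, rfl⟩ | ⟨rfl, rfl⟩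
            · -- from `inr i` to `inr (i + 1)`
              refine ⟨fun x hx => (nomatch hx), fun i' hi' => ?_⟩
              cases Sum.inr.inj hi'
              rcases ih.2 i rfl with ⟨⟨h0, hlo⟩, hp⟩ | ⟨hhi, hp⟩
              · refine Or.inl ⟨⟨h0, fun j hj => ?_⟩, hp⟩
                rcases Nat.lt_succ_iff_lt_or_eq.1 hj with hj' | hj'
                · exact hlo j hj'
                · have hji : j = i := Fin.ext hj'
                  rw [hji]
                  exact hc
              · exact Or.inr ⟨fun j hj => hhi j (Nat.le_of_succ_le hj), hp⟩
            · -- from `inr (i + 1)` to `inr i`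
              refine ⟨fun x hx => (nomatch hx), fun i' hi' => ?_⟩
              cases Sum.inr.inj hi'
              rcases ih.2 ⟨i.1 + 1, hlt⟩ rfl with ⟨⟨h0, hlo⟩, hp⟩ | ⟨hhi, hp⟩
              · exact Or.inl ⟨⟨h0, fun j hj => hlo j (Nat.lt_succ_of_lt hj)⟩, hp⟩
              · refine Or.inr ⟨fun j hj => ?_, hp⟩
                rcases Nat.eq_or_lt_of_le hj with hj' | hj'
                · have hji : j = i := Fin.ext hj'.symm
                  rw [hji]
                  exact hc
                · exact hhi j hj'
          · rw [pathNode_of_not_lt Z₁ e₀ n hlt] at hj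
            rcases hj with ⟨rfl, rfl⟩ | ⟨rfl, rfl⟩
            · -- from `inr i` (the last internal vertex) to `inl (snd e₀)`
              refine ⟨fun x hx => ?_, fun i' hi' => nomatch hi'⟩
              cases hx
              rcases ih.2 i rfl with ⟨⟨h0, hlo⟩, hp⟩ | ⟨-, hp⟩
              · -- every segment has colour `c`: the colouring agrees and `H` carries `e₀`
                have hag : pathAgree e₀ n ω' := fun j => by
                  rcases Nat.lt_or_ge j.1 i.1 with hj | hj
                  · exact (hlo j hj).trans h0.symm
                  · have hji : j = i := Fin.ext (by have := j.2; omega)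
                    rw [hji]
                    exact hc.trans h0.symm
                exact hp.tail ⟨e₀, hH3 hag, h0⟩
              · exact hp
            · -- from `inl (snd e₀)` to `inr i` (the last internal vertex)
              refine ⟨fun x hx => (nomatch hx), fun i' hi' => ?_⟩
              cases Sum.inr.inj hi'
              refine Or.inr ⟨fun j hj => ?_, ih.1 _ rfl⟩
              have hji : j = i := Fin.ext (by have := j.2; omega)
              rw [hji]
              exact hc
    exact (key _ h).1 v' rfl
  · intro h
    induction h with
    | refl => exact Relation.ReflTransGen.refl
    | tail hpath hstep ih =>
      rename_i x y
      obtain ⟨e, hj, hc⟩ := hstep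
      by_cases he : e = e₀
      · subst he
        rcases hH2 x y hj with rfl | ⟨hag, hxy⟩
        · exact ih
        · have hall : ∀ j : Fin n, ω' (Sum.inr j) = c := fun j => (hag j).trans hc
          rcases hxy with ⟨rfl, rfl⟩ | ⟨rfl, rfl⟩
          · exact ih.trans (path_chain Z₁ e n c ω' hc hall)
          · exact ih.trans (reflTransGen_symm (cAdj_symm _ _ _) (path_chain Z₁ e n c ω' hc hall))
      · exact ih.tail ⟨Sum.inl e, (path_joins_inl_of_ne Z₁ e₀ n he _ _).2 ⟨x, y, rfl, rfl, (hH1 e he x y).1 hj⟩,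
          hc⟩

end Reach

/-! ## The statuses of old vertices -/

section Statuses

variable (ω' : E₁ ⊕ Fin n → Bool)

/-- The colouring AGREES: paths of the path host between old vertices are paths of `Z₁`. -/
theorem reflTransGen_path_iff_agree (c : Bool) (h : pathAgree e₀ n ω') (v v' : V₁) :
    Relation.ReflTransGen (cAdj (pathHost Z₁ e₀ n) c ω') (Sum.inl v) (Sum.inl v') ↔
      Relation.ReflTransGen (cAdj Z₁ c fun e => ω' (Sum.inl e)) v v' :=
  reflTransGen_path_iff Z₁ e₀ n c ω' Z₁ (fun _ _ _ _ => Iff.rfl) (fun _ _ hxy => Or.inr ⟨h, hxy⟩)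
    (fun _ => Or.inl ⟨rfl, rfl⟩) v v'

/-- The colouring DISAGREES: paths of the path host between old vertices are paths of the loopified host. -/
theorem reflTransGen_path_iff_disagree (c : Bool) (h : ¬ pathAgree e₀ n ω') (v v' : V₁) :
    Relation.ReflTransGen (cAdj (pathHost Z₁ e₀ n) c ω') (Sum.inl v) (Sum.inl v') ↔
      Relation.ReflTransGen (cAdj (loopify Z₁ e₀) c fun e => ω' (Sum.inl e)) v v' :=
  reflTransGen_path_iff Z₁ e₀ n c ω' (loopify Z₁ e₀) (fun _ he x y => loopify_joins_of_ne Z₁ e₀ he x y)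
    (fun x y hxy => Or.inl (loopify_joins_self Z₁ e₀ x y hxy)) (fun hh => absurd hh h) v v'

/-- Merged status, colouring agreeing. -/
theorem Mg_path_agree (h : pathAgree e₀ n ω') (v v' : V₁) :
    (pathHost Z₁ e₀ n).Mg (Sum.inl v) (Sum.inl v') ω' ↔ Z₁.Mg v v' fun e => ω' (Sum.inl e) := by
  rw [Mg_iff_reflTransGen, Mg_iff_reflTransGen]
  exact reflTransGen_path_iff_agree Z₁ e₀ n ω' false h v v'

/-- Reached status, colouring agreeing. -/
theorem Rd_path_agree (h : pathAgree e₀ n ω') (v v' : V₁) :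
    (pathHost Z₁ e₀ n).Rd (Sum.inl v) (Sum.inl v') ω' ↔ Z₁.Rd v v' fun e => ω' (Sum.inl e) := by
  rw [Rd_iff_reflTransGen, Rd_iff_reflTransGen]
  exact reflTransGen_path_iff_agree Z₁ e₀ n ω' true h v v'

/-- Merged status, colouring disagreeing. -/
theorem Mg_path_disagree (h : ¬ pathAgree e₀ n ω') (v v' : V₁) :
    (pathHost Z₁ e₀ n).Mg (Sum.inl v) (Sum.inl v') ω' ↔ (loopify Z₁ e₀).Mg v v' fun e => ω' (Sum.inl e) := by
  rw [Mg_iff_reflTransGen, Mg_iff_reflTransGen]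
  exact reflTransGen_path_iff_disagree Z₁ e₀ n ω' false h v v'

/-- Reached status, colouring disagreeing. -/
theorem Rd_path_disagree (h : ¬ pathAgree e₀ n ω') (v v' : V₁) :
    (pathHost Z₁ e₀ n).Rd (Sum.inl v) (Sum.inl v') ω' ↔ (loopify Z₁ e₀).Rd v v' fun e => ω' (Sum.inl e) := by
  rw [Rd_iff_reflTransGen, Rd_iff_reflTransGen]
  exact reflTransGen_path_iff_disagree Z₁ e₀ n ω' true h v v'

end Statuses

end MultiExit

end ZoneZ

end PercRepro
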